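import Literature.NumberTheory.Automorphic.ArchSmallCellVanishing
import Literature.NumberTheory.Automorphic.ArchCasimirInvolution
import HarnessLib

/-!
# Multiplicity one for the cuspidal spectrum of `GL_n(𝔸_K)` — the discharge `multiplicity_one_gl_holds`

[cite: Shalika1974, Thm. 5.5 and §2]; [cite: Corvallis1979]; [cite: Shalika1973, §5, footnote 5 (p. 460)].

The named fact `multiplicity_one_gl n K μ` of `AutomorphicGLn` (lang.S20: the cuspidal spectrum
`L²_cusp(GL_n(𝔸_K) ⧸ A_G GL_n(K))` has multiplicity one; J. A. Shalika, *The multiplicity one theorem for `GL_n`*,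
Ann. of Math. 100 (1974), Thm. 5.5; I. Piatetski-Shapiro, *Multiplicity one theorems*, Corvallis 1979) is proved.

The tree reduces it (`multiplicity_one_gl_of_casimirSmallCellVanishing`, `ArchCasimirInvolution`: the global
argument of Shalika Thm. 5.5 over the tree's `L²` objects, the non-archimedean and the Gelfand–Kazhdan reductions,
and the big-cell symmetry) to the archimedean small-cell vanishing theorem for bi-`ψ_∞`-quasi-invariant Casimir
eigendistributions on `GL_n(K_∞)` (Shalika (1974), §2; the Casimir hypothesis of Shalika (1973), fn. 5), which is
`casimirSmallCellVanishing` (`ArchSmallCellVanishing`).  This file only assembles the two.  (It is a sibling proof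
file: `AutomorphicGLn` itself cannot import the archimedean analysis, which imports it.)

Theorems only; no new facts.
-/

noncomputable section

open MeasureTheory

namespace Literature.NumberTheory.Automorphic

variable {n : ℕ} {K : Type} [Field K] [NumberField K]
  {μ : Measure (AdelicGroupData.gl n K).automorphicQuotient} [(AdelicGroupData.gl n K).IsAutomorphicMeasure μ]

/-- **Multiplicity one for `L²_cusp(GL_n(𝔸_K))`** (Shalika (1974), Thm. 5.5; Piatetski-Shapiro (1979)): the
discharge of the named fact `multiplicity_one_gl`. [cite: Shalika1974, Thm. 5.5] [cite: Corvallis1979] -/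
theorem multiplicity_one_gl_holds : multiplicity_one_gl n K μ :=
  multiplicity_one_gl_of_casimirSmallCellVanishing n K μ fun D hD hL hR hC _ hbig =>
    casimirSmallCellVanishing D hD hL hR hC hbig

end Literature.NumberTheory.Automorphic
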